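import Summits.MatrixMultiplication.OmegaCensus.SmallFormats.RankOnePlaneCapRotate
import HarnessLib

/-!
# ω-census family (a): the QUANTITATIVE rank-one plane cap `(m−1)·|R| ≤ m·(r − (m+1)n)`

Cell `pub-omega` (unit `pub-omega-lit`, gen 5), topic `Summits/MatrixMultiplication/OmegaCensus`
(sub-folder `SmallFormats`). Framing (verbatim): lottery ticket; floor = certified bounds/negative
ranges. HONEST FRAMING: our elementary structural lemma, sharpening `RankOnePlaneCapGeneral`
(`|R| ≤ r − mn − 1`); a CAP for the structured searches of the census, not a bound on any rank, not
progress on `ω`. It is attained with equality by the Hopcroft–Kerr schemes for `⟨2,2,n⟩`, `n = 2,3,4,5`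
(`r = 7, 11, 14, 18`: `|R| = 2, 4, 4, 6`; checked numerically outside Lean).

**Theorem** (`card_vanishing_quant`). `k` a field, `c ≥ 2`, `β` a bilinear computation of `⟨c,m,n⟩`
(`X ∈ k^{c×m}`, `Y ∈ k^{m×n}`) of length `r`, `λ ∈ k^c ∖ 0`, `R` a set of indices whose X-forms vanish on
the plane `S^λ = {λ zᵀ : z ∈ k^m}`. Then `m·mn + mn + m|R| ≤ m r + |R|`, i.e.
`(m − 1)|R| ≤ m (r − (m+1) n)`; for `m = 2` (all `⟨c,2,n⟩`, in particular `⟨2,2,n⟩`): **`|R| ≤ 2r − 6n`**.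
Instances: `⟨2,2,5⟩ @ 17 ⇒ |R| ≤ 4` (substitution: 7; first-order cap: 6), `@ 18 ⇒ 6`, `@ 19 ⇒ 8`;
`⟨2,3,3⟩ @ 14 ⇒ |R| ≤ 3`. By the transpose dual the same numbers hold for the planes `{z λᵀ}` when
`c = m` (`⟨2,2,n⟩`: `≤ 2r − 6n` on all `2(q+1)` rank-one planes of `M₂(𝔽_q)`).

*Proof.* Put `Rᶜ` = the other terms, `φ_t(z,Y) = f_t(λzᵀ) g_t(Y)` (`t ∈ Rᶜ`), `θ ⊥ λ`, `θ ≠ 0`.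
(1) `dim span{θᵀW_t : t ∈ Rᶜ} ≤ |Rᶜ| − mn`: by induction on `|Rᶜ|` over all output assignments — if
the `φ_t` are linearly independent, the `θ`-row of `λzᵀY = ∑ φ_t W_t` (which is `0`) forces every
`θᵀW_t = 0`, and `|Rᶜ| ≥ mn` by the Y-flattening; otherwise eliminate a term `t₀` with a dependency
(`W_t ↦ W_t − (e_t/e_{t₀}) W_{t₀}`), which changes the span by at most the line `k θᵀW_{t₀}`.
(2) If `Y₀` is a common zero of the `g_t`, `t ∈ R`, then the `θ`-row of the full identity gives
`(θᵀX) Y₀ ∈ E := span{θᵀW_t : t ∈ Rᶜ}` for every `X`, so every row of `Y₀` lies in `E`; hence the common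
zeros have dimension `≤ m·dim E` and `|R| ≥ mn − m·dim E ≥ mn − m(|Rᶜ| − mn)`. Rearranging gives the
claim.
-/

namespace Summit.MatrixMultiplication.OmegaCensus.RankOnePlaneCapGeneral

open Module Matrix Literature.Computability.AlgebraicComplexity

variable {k : Type*} [Field k] {c m n : ℕ} {ι : Type*} [Fintype ι]

/-- Step (1): along any computation `λ zᵀ Y = ∑_{i∈J} a_i(z) g_i(Y) • W'_i` with `θ ᵥ* (λ zᵀ) = 0`, the
`θ`-rows of the outputs span at most `|J| − mn` dimensions. -/
theorem finrank_span_rows_add_le (g : ι → Module.Dual k (Matrix (Fin m) (Fin n) k))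
    {lam : Fin c → k} (hlam : lam ≠ 0) (a : ι → (Fin m → k) → k) (θ : Fin c → k)
    (hθ : ∀ z : Fin m → k, θ ᵥ* vecMulVec lam z = 0) :
    ∀ (N : ℕ) (J : Finset ι) (W' : ι → Matrix (Fin c) (Fin n) k), J.card = N →
      (∀ (z : Fin m → k) (Y : Matrix (Fin m) (Fin n) k),
        vecMulVec lam z * Y = ∑ i ∈ J, (a i z * g i Y) • W' i) →
      finrank k (Submodule.span k ((fun i => θ ᵥ* W' i) '' ↑J)) + m * n ≤ J.card := by
  classical
  intro N
  induction N with
  | zero =>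
      intro J W' hJ h
      have h0 : m * n ≤ J.card := mn_le_card_of_restr g hlam J a W' h
      have hJe : J = ∅ := Finset.card_eq_zero.1 hJ
      subst hJe
      have hmn : m * n = 0 := by simpa using h0
      simp [hmn]
  | succ N ih =>
      intro J W' hJ h
      by_cases hind : ∀ e : ι → k, (∀ (z : Fin m → k) (Y : Matrix (Fin m) (Fin n) k),
          ∑ i ∈ J, e i * (a i z * g i Y) = 0) → ∀ i ∈ J, e i = 0
      · -- independent: all `θ`-rows vanish
        have hrow : ∀ i ∈ J, θ ᵥ* W' i = 0 := by
          intro i hi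
          ext ν
          have hc := hind (fun j => (θ ᵥ* W' j) ν) ?_ i hi
          · simpa using hc
          · intro z Y
            have h1 : θ ᵥ* (vecMulVec lam z * Y) = θ ᵥ* ∑ i ∈ J, (a i z * g i Y) • W' i := by
              rw [h z Y]
            rw [← Matrix.vecMul_vecMul, hθ z, Matrix.zero_vecMul, vecMul_sum_smul] at h1
            have h2 := congrFun h1 ν
            rw [Pi.zero_apply, Finset.sum_apply] at h2
            refine Eq.trans (Finset.sum_congr rfl fun j _ => ?_) h2.symm
            simp [mul_comm]
        have hspan : Submodule.span k ((fun i => θ ᵥ* W' i) '' ↑J) = ⊥ := by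
          rw [Submodule.span_eq_bot]
          rintro x ⟨i, hi, rfl⟩
          exact hrow i hi
        rw [hspan, finrank_bot, zero_add]
        exact mn_le_card_of_restr g hlam J a W' h
      · -- dependent: eliminate one term
        simp only [not_forall, exists_prop] at hind
        obtain ⟨e, he, i0, hi0, he0⟩ := hind
        set J' : Finset ι := J.erase i0 with hJ'
        have hJ'c : J'.card = N := by rw [hJ', Finset.card_erase_of_mem hi0, hJ]; rfl
        set W'' : ι → Matrix (Fin c) (Fin n) k := fun i => W' i - (e i / e i0) • W' i0 with hW''
        have hid : ∀ (z : Fin m → k) (Y : Matrix (Fin m) (Fin n) k), vecMulVec lam z * Y =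
            ∑ i ∈ J', (a i z * g i Y) • W'' i := by
          intro z Y
          set t : ι → k := fun i => a i z * g i Y with ht
          have e1 : vecMulVec lam z * Y = t i0 • W' i0 + ∑ i ∈ J', t i • W' i := by
            rw [h z Y, hJ', Finset.add_sum_erase J (fun i => t i • W' i) hi0]
          have e2 : e i0 * t i0 + ∑ i ∈ J', e i * t i = 0 := by
            rw [hJ', Finset.add_sum_erase J (fun i => e i * t i) hi0]
            exact he z Y
          have e4 : t i0 = -(∑ i ∈ J', (e i / e i0) * t i) := by
            have h6 : t i0 = (e i0)⁻¹ * (e i0 * t i0) := by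
              rw [← mul_assoc, inv_mul_cancel₀ he0, one_mul]
            rw [h6, eq_neg_of_add_eq_zero_left e2, mul_neg, Finset.mul_sum]
            congr 1
            refine Finset.sum_congr rfl fun i _ => ?_
            rw [div_eq_mul_inv]
            ring
          calc vecMulVec lam z * Y = t i0 • W' i0 + ∑ i ∈ J', t i • W' i := e1
            _ = ∑ i ∈ J', (t i • W' i - ((e i / e i0) * t i) • W' i0) := by
                rw [e4, Finset.sum_sub_distrib, ← Finset.sum_smul, neg_smul]
                abel
            _ = ∑ i ∈ J', t i • W'' i :=
                Finset.sum_congr rfl fun i _ => by rw [hW'', smul_sub, smul_smul, mul_comm]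
        have hIH := ih J' W'' hJ'c hid
        -- the span for `J, W'` sits inside the span for `J', W''` plus the line of `θ ᵥ* W' i0`
        have hle : Submodule.span k ((fun i => θ ᵥ* W' i) '' ↑J) ≤
            Submodule.span k ((fun i => θ ᵥ* W'' i) '' ↑J') ⊔ Submodule.span k {θ ᵥ* W' i0} := by
          rw [Submodule.span_le]
          rintro x ⟨i, hi, rfl⟩
          change θ ᵥ* W' i ∈ _
          by_cases hii : i = i0
          · subst hii
            exact Submodule.mem_sup_right (Submodule.subset_span rfl)
          · have hiJ' : i ∈ J' := by rw [hJ']; exact Finset.mem_erase.2 ⟨hii, hi⟩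
            have hdec : θ ᵥ* W' i = θ ᵥ* W'' i + (e i / e i0) • (θ ᵥ* W' i0) := by
              rw [hW'']
              simp only
              rw [Matrix.vecMul_sub, vecMul_smul_matrix, sub_add_cancel]
            rw [hdec]
            exact Submodule.add_mem_sup (Submodule.subset_span ⟨i, by exact_mod_cast hiJ', rfl⟩)
              (Submodule.smul_mem _ _ (Submodule.subset_span rfl))
        have h1 := Submodule.finrank_mono hle
        have h2 := Submodule.finrank_add_le_finrank_add_finrank
          (Submodule.span k ((fun i => θ ᵥ* W'' i) '' ↑J')) (Submodule.span k {θ ᵥ* W' i0})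
        have h3 : finrank k (Submodule.span k ({θ ᵥ* W' i0} : Set (Fin n → k))) ≤ 1 := by
          have := finrank_span_le_card (R := k) ({θ ᵥ* W' i0} : Set (Fin n → k))
          simpa using this
        have hJN : J.card = N + 1 := hJ
        omega

/-- Step (2): if the `θ`-rows of all outputs outside `R` lie in `E` (`θ` with a nonzero coordinate),
then the common zeros of the Y-forms of `R` have all rows in `E`, so `mn ≤ |R| + m·dim E`. -/
theorem mn_le_card_add (β : BilinComp (mulBilin k c m n) ι) {θ : Fin c → k} {κ' : Fin c}
    (hκ' : θ κ' ≠ 0) (R : Finset ι) (E : Submodule k (Fin n → k))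
    (hE : ∀ i, i ∉ R → θ ᵥ* β.w i ∈ E) : m * n ≤ R.card + m * finrank k E := by
  classical
  let G : Matrix (Fin m) (Fin n) k →ₗ[k] ({i // i ∈ R} → k) :=
    LinearMap.pi fun i : {i // i ∈ R} => β.g i.1
  -- rows of common zeros lie in `E`
  have hrow : ∀ Y ∈ LinearMap.ker G, ∀ μ : Fin m, (Y μ : Fin n → k) ∈ E := by
    intro Y hY μ
    have hY' : ∀ i ∈ R, β.g i Y = 0 := fun i hi => by
      have := congrFun (LinearMap.mem_ker.1 hY) ⟨i, hi⟩
      simpa [G] using this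
    have h := β.map_eq_sum (Matrix.single κ' μ (1 : k)) Y
    rw [mulBilin_apply] at h
    have h1 : θ ᵥ* (Matrix.single κ' μ (1 : k) * Y) = θ κ' • Y μ := by
      ext ν
      simp [Matrix.vecMul, dotProduct, single_mul_apply']
    have hmem : θ ᵥ* (Matrix.single κ' μ (1 : k) * Y) ∈ E := by
      rw [h, vecMul_sum_smul]
      refine Submodule.sum_mem _ fun i _ => ?_
      by_cases hiR : i ∈ R
      · rw [hY' i hiR, mul_zero, zero_smul]
        exact Submodule.zero_mem _
      · exact Submodule.smul_mem _ _ (hE i hiR)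
    have h2 : Y μ = (θ κ')⁻¹ • (θ κ' • Y μ) := by rw [smul_smul, inv_mul_cancel₀ hκ', one_smul]
    rw [h2, ← h1]
    exact Submodule.smul_mem _ _ hmem
  -- `ker G ↪ (Fin m → E)`
  let ψ : LinearMap.ker G →ₗ[k] (Fin m → E) :=
    { toFun := fun Y μ => ⟨(Y : Matrix (Fin m) (Fin n) k) μ, hrow Y Y.2 μ⟩
      map_add' := fun Y Y' => by ext μ ν; rfl
      map_smul' := fun a Y => by ext μ ν; rfl }
  have hψ : Function.Injective ψ := by
    intro Y Y' hYY
    apply Subtype.ext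
    ext μ ν
    have := congrArg (fun F => ((F μ : E) : Fin n → k) ν) hYY
    simpa [ψ] using this
  have hker : finrank k (LinearMap.ker G) ≤ m * finrank k E := by
    have := LinearMap.finrank_le_finrank_of_injective hψ
    rw [Module.finrank_pi_fintype] at this
    simpa [Finset.sum_const, Finset.card_fin] using this
  have hrange : finrank k (LinearMap.range G) ≤ R.card := by
    have := Submodule.finrank_le (LinearMap.range G)
    rw [Module.finrank_fintype_fun_eq_card, Fintype.card_coe] at this
    exact this
  have hrn := LinearMap.finrank_range_add_finrank_ker G
  have htop : finrank k (Matrix (Fin m) (Fin n) k) = m * n := by simp [Module.finrank_matrix]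
  omega

/-- **Quantitative rank-one plane cap.** For a bilinear computation of `⟨c,m,n⟩` (`c ≥ 2`) of length
`r` and a set `R` of indices whose X-forms vanish on `{λ zᵀ : z ∈ k^m}` (`λ ≠ 0`):
`m·mn + mn + m|R| ≤ m r + |R|`, i.e. `(m−1)|R| ≤ m(r − (m+1)n)`. -/
theorem card_vanishing_quant (hc : 2 ≤ c) (β : BilinComp (mulBilin k c m n) ι)
    {lam : Fin c → k} (hlam : lam ≠ 0) (R : Finset ι)
    (hR : ∀ i ∈ R, ∀ z : Fin m → k, β.f i (vecMulVec lam z) = 0) :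
    m * (m * n) + m * n + m * R.card ≤ m * Fintype.card ι + R.card := by
  classical
  set Rc : Finset ι := Finset.univ \ R with hRc
  have hcardR : Rc.card + R.card = Fintype.card ι := by
    rw [hRc, Finset.card_sdiff_add_card_eq_card (Finset.subset_univ R), Finset.card_univ]
  have A1 : ∀ (z : Fin m → k) (Y : Matrix (Fin m) (Fin n) k), vecMulVec lam z * Y =
      ∑ i ∈ Rc, (β.f i (vecMulVec lam z) * β.g i Y) • β.w i := by
    intro z Y
    have h := β.map_eq_sum (vecMulVec lam z) Y
    rw [mulBilin_apply] at h
    rw [h, ← Finset.sum_sdiff (Finset.subset_univ R), add_eq_left]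
    exact Finset.sum_eq_zero fun i hi => by rw [hR i hi, zero_mul, zero_smul]
  -- `θ ⊥ λ` with a nonzero coordinate
  obtain ⟨κ₁, hκ₁⟩ : ∃ κ, lam κ ≠ 0 := by
    by_contra h0
    simp only [not_exists, not_not] at h0
    exact hlam (funext h0)
  obtain ⟨κ₂, hκ₂⟩ : ∃ κ : Fin c, κ ≠ κ₁ := by
    by_cases h0 : κ₁ = ⟨0, by omega⟩
    · exact ⟨⟨1, by omega⟩, fun h => by rw [h0] at h; exact absurd (congrArg Fin.val h) (by simp)⟩
    · exact ⟨⟨0, by omega⟩, fun h => h0 h.symm⟩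
  set θ : Fin c → k := Pi.single κ₂ (lam κ₁) - Pi.single κ₁ (lam κ₂) with hθ
  have hθdot : θ ⬝ᵥ lam = 0 := by
    rw [hθ, sub_dotProduct, single_dotProduct, single_dotProduct]
    ring
  have hθlam : ∀ z : Fin m → k, θ ᵥ* vecMulVec lam z = 0 := by
    intro z
    ext μ
    have : (θ ᵥ* vecMulVec lam z) μ = (θ ⬝ᵥ lam) * z μ := by
      simp [Matrix.vecMul, dotProduct, vecMulVec_apply, Finset.sum_mul, mul_assoc]
    rw [this, hθdot, zero_mul, Pi.zero_apply]
  have hκ' : θ κ₂ ≠ 0 := by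
    rw [hθ, Pi.sub_apply, Pi.single_eq_same, Pi.single_eq_of_ne hκ₂, sub_zero]
    exact hκ₁
  -- step (1)
  set E : Submodule k (Fin n → k) := Submodule.span k ((fun i => θ ᵥ* β.w i) '' ↑Rc) with hEdef
  have L1 : finrank k E + m * n ≤ Rc.card :=
    finrank_span_rows_add_le β.g hlam (fun i z => β.f i (vecMulVec lam z)) θ hθlam Rc.card Rc β.w
      rfl A1
  -- step (2)
  have L2 : m * n ≤ R.card + m * finrank k E := by
    refine mn_le_card_add β hκ' R E fun i hiR => ?_
    have hiRc : i ∈ Rc := Finset.mem_sdiff.2 ⟨Finset.mem_univ i, hiR⟩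
    exact Submodule.subset_span ⟨i, by exact_mod_cast hiRc, rfl⟩
  have L1' : m * finrank k E + m * (m * n) ≤ m * Rc.card := by
    have := Nat.mul_le_mul_left m L1
    rwa [Nat.mul_add] at this
  have hm : m * Rc.card + m * R.card = m * Fintype.card ι := by rw [← Nat.mul_add, hcardR]
  omega

/-- **`m = 2`: `|R| ≤ 2r − 6n`** for every `⟨c,2,n⟩` with `c ≥ 2` (in particular `⟨2,2,n⟩`). -/
theorem card_vanishing_le_two_mul_sub (hc : 2 ≤ c) (β : BilinComp (mulBilin k c 2 n) ι)
    {lam : Fin c → k} (hlam : lam ≠ 0) (R : Finset ι)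
    (hR : ∀ i ∈ R, ∀ z : Fin 2 → k, β.f i (vecMulVec lam z) = 0) :
    R.card + 6 * n ≤ 2 * Fintype.card ι := by
  have := card_vanishing_quant hc β hlam R hR
  omega

/-- Column planes `{z λᵀ : z ∈ k^c}` (`λ ∈ k^m ∖ 0`, `m ≥ 2`): `c·cn + cn + c|R| ≤ c r + |R|`. -/
theorem card_vanishing_col_quant (hm : 2 ≤ m) (β : BilinComp (mulBilin k c m n) ι)
    {lam : Fin m → k} (hlam : lam ≠ 0) (R : Finset ι)
    (hR : ∀ i ∈ R, ∀ z : Fin c → k, β.f i (vecMulVec z lam) = 0) :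
    c * (c * n) + c * n + c * R.card ≤ c * Fintype.card ι + R.card := by
  obtain ⟨β', hβ'⟩ := exists_transposeDual β
  refine card_vanishing_quant hm β' hlam R fun i hi z => ?_
  rw [hβ', Matrix.transpose_vecMulVec]
  exact hR i hi z

/-- **Census instance `⟨2,2,5⟩ @ 17`**: in a 17-term bilinear algorithm for `⟨2,2,5⟩` (any field), AT
MOST `4` X-forms vanish on any rank-one plane `{λ zᵀ}` or `{z λᵀ}` (substitution: `7`). -/
theorem card_vanishing_le_four_225 {ι : Type*} [Fintype ι] (h17 : Fintype.card ι = 17)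
    (β : BilinComp (mulBilin k 2 2 5) ι) {lam : Fin 2 → k} (hlam : lam ≠ 0) (R R' : Finset ι)
    (hR : ∀ i ∈ R, ∀ z : Fin 2 → k, β.f i (vecMulVec lam z) = 0)
    (hR' : ∀ i ∈ R', ∀ z : Fin 2 → k, β.f i (vecMulVec z lam) = 0) :
    R.card ≤ 4 ∧ R'.card ≤ 4 := by
  have h1 := card_vanishing_quant (le_refl 2) β hlam R hR
  have h2 := card_vanishing_col_quant (le_refl 2) β hlam R' hR'
  constructor <;> omega

/-- **Census instance `⟨2,2,5⟩ @ 18`** (length of the Hopcroft–Kerr scheme, where the value `6` is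
attained): at most `6` X-forms vanish on any rank-one plane. -/
theorem card_vanishing_le_six_225_at18 {ι : Type*} [Fintype ι] (h18 : Fintype.card ι = 18)
    (β : BilinComp (mulBilin k 2 2 5) ι) {lam : Fin 2 → k} (hlam : lam ≠ 0) (R R' : Finset ι)
    (hR : ∀ i ∈ R, ∀ z : Fin 2 → k, β.f i (vecMulVec lam z) = 0)
    (hR' : ∀ i ∈ R', ∀ z : Fin 2 → k, β.f i (vecMulVec z lam) = 0) :
    R.card ≤ 6 ∧ R'.card ≤ 6 := by
  have h1 := card_vanishing_quant (le_refl 2) β hlam R hR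
  have h2 := card_vanishing_col_quant (le_refl 2) β hlam R' hR'
  constructor <;> omega

/-- **Census instance `⟨2,3,3⟩ @ 14`** (the open `𝔽₃` cell `(233, 14)`): at most `3` X-forms vanish on
any plane `{λ zᵀ : z ∈ k³} ⊂ k^{2×3}` (substitution: `5`). -/
theorem card_vanishing_le_three_233 {ι : Type*} [Fintype ι] (h14 : Fintype.card ι = 14)
    (β : BilinComp (mulBilin k 2 3 3) ι) {lam : Fin 2 → k} (hlam : lam ≠ 0) (R : Finset ι)
    (hR : ∀ i ∈ R, ∀ z : Fin 3 → k, β.f i (vecMulVec lam z) = 0) : R.card ≤ 3 := by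
  have := card_vanishing_quant (le_refl 2) β hlam R hR
  omega

/-- **Quantitative Y-side cap** (via the cyclic rotation `⟨c,m,n⟩ → ⟨m,n,c⟩`, needs `m ≥ 2`): for the
Y-forms vanishing on `{λ zᵀ : z ∈ k^n} ⊂ k^{m×n}` (`λ ∈ k^m ∖ 0`):
`n·nc + nc + n|R| ≤ n r + |R|`, i.e. `(n−1)|R| ≤ n(r − (n+1)c)`. -/
theorem card_gVanishing_quant (hm : 2 ≤ m) (β : BilinComp (mulBilin k c m n) ι)
    {lam : Fin m → k} (hlam : lam ≠ 0) (R : Finset ι)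
    (hR : ∀ i ∈ R, ∀ z : Fin n → k, β.g i (vecMulVec lam z) = 0) :
    n * (n * c) + n * c + n * R.card ≤ n * Fintype.card ι + R.card := by
  obtain ⟨β', hf, -, -⟩ := exists_rotate β
  refine card_vanishing_quant hm β' hlam R fun i hi z => ?_
  rw [hf]
  exact hR i hi z

/-- **Quantitative output-side cap** (via two rotations and the transpose dual, needs `c ≥ 2`): for the
outputs with `λᵀ W_i = 0` (`λ ∈ k^c ∖ 0`): `n·nm + nm + n|R| ≤ n r + |R|`, i.e.
`(n−1)|R| ≤ n(r − (n+1)m)`. -/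
theorem card_wRowPlane_quant (hc : 2 ≤ c) (β : BilinComp (mulBilin k c m n) ι)
    {lam : Fin c → k} (hlam : lam ≠ 0) (R : Finset ι) (hR : ∀ i ∈ R, lam ᵥ* β.w i = 0) :
    n * (n * m) + n * m + n * R.card ≤ n * Fintype.card ι + R.card := by
  classical
  obtain ⟨β', -, hg, -⟩ := exists_rotate β
  obtain ⟨β'', hf'', -, -⟩ := exists_rotate β'
  refine card_vanishing_col_quant hc β'' hlam R fun i hi z => ?_
  rw [hf'', hg]
  have h0 := hR i hi
  calc ∑ κ, ∑ ν, β.w i κ ν * vecMulVec z lam ν κ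
      = ∑ ν, z ν * (lam ᵥ* β.w i) ν := by
          rw [Finset.sum_comm]
          refine Finset.sum_congr rfl fun ν _ => ?_
          simp only [Matrix.vecMul, dotProduct, vecMulVec_apply, Finset.mul_sum]
          exact Finset.sum_congr rfl fun κ _ => by ring
    _ = 0 := by simp [h0]

/-- **Census instance `⟨2,3,4⟩ @ 19`** (the `𝔽₂` ticket `R_𝔽₂(⟨2,3,4⟩) ≥ 20?`; valid over every field;
`X ∈ k^{2×3}`, `Y ∈ k^{3×4}`): in a 19-term algorithm at most `4` X-forms vanish on any plane
`{λ zᵀ : z ∈ k³}` (substitution: `7`) and at most `5` outputs `W_i ∈ k^{2×4}` satisfy `λᵀW_i = 0`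
(separation: `7`). -/
theorem card_le_234_at19 {ι : Type*} [Fintype ι] (h19 : Fintype.card ι = 19)
    (β : BilinComp (mulBilin k 2 3 4) ι) {lam : Fin 2 → k} (hlam : lam ≠ 0) (R R' : Finset ι)
    (hR : ∀ i ∈ R, ∀ z : Fin 3 → k, β.f i (vecMulVec lam z) = 0)
    (hR' : ∀ i ∈ R', lam ᵥ* β.w i = 0) : R.card ≤ 4 ∧ R'.card ≤ 5 := by
  have h1 := card_vanishing_quant (le_refl 2) β hlam R hR
  have h2 := card_wRowPlane_quant (le_refl 2) β hlam R' hR'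
  constructor <;> omega

/-- **Census instance `⟨2,3,3⟩ @ 14`, output side**: at most `3` outputs `W_i ∈ k^{2×3}` of a 14-term
algorithm satisfy `λᵀ W_i = 0` (separation: `5`). -/
theorem card_wRowPlane_le_three_233 {ι : Type*} [Fintype ι] (h14 : Fintype.card ι = 14)
    (β : BilinComp (mulBilin k 2 3 3) ι) {lam : Fin 2 → k} (hlam : lam ≠ 0) (R : Finset ι)
    (hR : ∀ i ∈ R, lam ᵥ* β.w i = 0) : R.card ≤ 3 := by
  have := card_wRowPlane_quant (le_refl 2) β hlam R hR
  omega

end Summit.MatrixMultiplication.OmegaCensus.RankOnePlaneCapGeneral
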